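import Literature.NumberTheory.EllipticCurves.IwasawaAlgebraMuVanishingProofs
import HarnessLib

/-!
# Promotion of a `p`-localized containment of characteristic ideals under a `μ`-INEQUALITY

Theorems only (no new definitions, no named facts, no instances, no notation). For finitely
generated torsion modules `X`, `Y` over the Iwasawa algebra `Λ = ℤ_p⟦T⟧`:

  `(p^k) · char_Λ(Y)^2 ⊆ char_Λ(X)` and `μ(X) ≤ 2 μ(Y)` ⟹ `char_Λ(Y)^2 ⊆ char_Λ(X)`

(`IwasawaAlgebra.sq_charIdeal_le_charIdeal_of_span_p_pow_mul_le_of_muInvariant_le`), together with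
the un-squared form `(p^k) · char_Λ(Y) ⊆ char_Λ(X)`, `μ(X) ≤ μ(Y)` ⟹ `char_Λ(Y) ⊆ char_Λ(X)`,
and both again with the `μ`-hypothesis in the `lengthAt` currency at `𝔭 = (p)` (`…_of_lengthAt_le`).
This is the exact algebra by which a Howard/Kolyvagin containment proved only after inverting `p`
("`(p^m) · char(𝔖/ℋ)^2 ⊆ char(X_tors)` for some `m`", the shape of the tree's pinned stub
`stub_muPartTied` of `Summits/BirchSwinnertonDyer/…/Theses/PrintX10b.lean`,
`HowardContainmentAnyClassNumberX10bPinnedOfPrint`) is promoted to the integral containment by a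
SEPARATE comparison of `μ`-invariants — B. Howard, *The Heegner point Kolyvagin system*, Compos.
Math. 140 (2004), proof of Thm. 2.2.10, p. 18 of arXiv:1202.6340: "The case `𝔓 = pΛ` is dealt with
in an entirely similar fashion, taking `𝔮 = T^m + p`", whose output is precisely the
inequality `ord_{(p)} char(X_tors) ≤ 2 · ord_{(p)} char(𝔖/ℋ)`, i.e. `μ(X) ≤ 2 μ(Y)` — and it
sharpens the tree's `IwasawaAlgebra.le_charIdeal_of_span_p_pow_mul_le`
(`IwasawaAlgebraPromotionProofs.lean`), which needs the stronger hypothesis `μ(X) = 0`.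

Proof (Washington §13.2 bookkeeping; all inputs are tree theorems): by the structure theorem
(`exists_isPseudoIsomorphism_elementary_holds`) `X ∼ E(μs, fs)`, `Y ∼ E(νs, gs)` with distinguished
`fⱼ`, `gⱼ`; hence `char X = (p^a · D_X)`, `char Y = (p^b · D_Y)` with `a = μ(X)`, `b = μ(Y)`
(`charIdeal_eq_span_holds`, `muInvariant_eq_sum_holds`) and `p ∤ D_X` (`C_dvd_charElement_iff`:
`p` is prime in `Λ` and divides no distinguished polynomial). The hypothesis reads
`p^a D_X ∣ p^{k+2b} D_Y^2`; cancelling the prime `p` against `D_X` (`dvd_of_dvd_prime_pow_mul`, an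
induction on the exponent using only `Prime.dvd_or_dvd` and cancellation in the domain `Λ`) gives
`D_X ∣ D_Y^2`, and `a ≤ 2b` gives `p^a ∣ p^{2b}`; multiply. (The cancellation lemma is a private
helper.)

## References
* L. Washington, *Introduction to Cyclotomic Fields*, 2nd ed., GTM 83, §13.2. [Washington1997]
* B. Howard, *The Heegner point Kolyvagin system*, Compos. Math. 140 (2004) 1439–1472, proof of
  Thm. 2.2.10 (arXiv:1202.6340, p. 18). [Howard2004]
-/

set_option autoImplicit false

noncomputable section

open scoped Polynomial

namespace Literature.NumberTheory.EllipticCurves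

/-- Cancelling a prime power against a coprime divisor: if `π` is prime, `π ∤ d` and
`d ∣ πⁿ z`, then `d ∣ z` (induction on `n`; `Prime.dvd_or_dvd` and cancellation of `π ≠ 0`).
[folklore] -/
private theorem dvd_of_dvd_prime_pow_mul {R : Type*} [CommMonoidWithZero R] [IsCancelMulZero R]
    {π d z : R} (hπ : Prime π) (hd : ¬ π ∣ d) : ∀ (n : ℕ), d ∣ π ^ n * z → d ∣ z
  | 0, h => by simpa using h
  | n + 1, h => by
    have h' : d ∣ π ^ n * (π * z) := by rwa [← mul_assoc, ← pow_succ]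
    obtain ⟨w, hw⟩ := dvd_of_dvd_prime_pow_mul hπ hd n h'
    -- `hw : π * z = d * w`, so `π ∣ d * w`, hence `π ∣ w`
    have hdw : π ∣ d * w := ⟨z, hw.symm⟩
    rcases hπ.dvd_or_dvd hdw with h1 | ⟨w', rfl⟩
    · exact absurd h1 hd
    · refine ⟨w', mul_left_cancel₀ hπ.ne_zero ?_⟩
      rw [hw, mul_left_comm]

open IwasawaAlgebra EllipticCurves.Module

variable {p : ℕ} [Fact p.Prime]

/-- `p` divides no product of powers of distinguished polynomials in `Λ` (the `μs = []` case of
`C_dvd_charElement_iff`). [cite: Washington1997, §13.2] -/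
theorem not_C_dvd_prod_pow_of_isDistinguishedAt {fs : List (ℤ_[p][X] × ℕ)}
    (hfs : ∀ f ∈ fs, f.1.IsDistinguishedAt (IsLocalRing.maximalIdeal ℤ_[p])) :
    ¬ PowerSeries.C (p : ℤ_[p]) ∣ (fs.map fun f => (f.1 : IwasawaAlgebra p) ^ f.2).prod := by
  intro h
  have h' : PowerSeries.C (p : ℤ_[p]) ∣ charElement p [] fs := by
    simpa [charElement] using h
  exact ((C_dvd_charElement_iff (μs := ([] : List ℕ)) hfs).mp h') (by simp)

/-- The characteristic element `p^{∑ μᵢ} ∏ fⱼ^{nⱼ}` written with the prime `C p` of `Λ` pulled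
out as a power. [cite: Washington1997, §13.2] -/
theorem charElement_eq_C_pow_mul (μs : List ℕ) (fs : List (ℤ_[p][X] × ℕ)) :
    charElement p μs fs = PowerSeries.C (p : ℤ_[p]) ^ μs.sum *
      (fs.map fun f => (f.1 : IwasawaAlgebra p) ^ f.2).prod := by
  rw [charElement, map_pow]

namespace IwasawaAlgebra

/-- **A `μ`-inequality promotes a `p`-localized containment (un-squared form).** For finitely
generated torsion `Λ`-modules `X`, `Y`: `(p^k) · char(Y) ⊆ char(X)` and `μ(X) ≤ μ(Y)` imply
`char(Y) ⊆ char(X)`. Washington §13.2. [cite: Washington1997, §13.2] -/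
theorem charIdeal_le_charIdeal_of_span_p_pow_mul_le_of_muInvariant_le
    {X : Type*} [AddCommGroup X] [_root_.Module (IwasawaAlgebra p) X]
    {Y : Type*} [AddCommGroup Y] [_root_.Module (IwasawaAlgebra p) Y]
    [Module.Finite (IwasawaAlgebra p) X] [Module.Finite (IwasawaAlgebra p) Y]
    (hX : Module.IsTorsion (IwasawaAlgebra p) X) (hY : Module.IsTorsion (IwasawaAlgebra p) Y)
    {k : ℕ}
    (h : Ideal.span {(p : IwasawaAlgebra p) ^ k} * Module.charIdeal (IwasawaAlgebra p) Y ≤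
      Module.charIdeal (IwasawaAlgebra p) X)
    (hμ : muInvariant p X ≤ muInvariant p Y) :
    Module.charIdeal (IwasawaAlgebra p) Y ≤ Module.charIdeal (IwasawaAlgebra p) X := by
  obtain ⟨μs, fs, -, hfs, hψ⟩ := exists_isPseudoIsomorphism_elementary_holds p X hX
  obtain ⟨νs, gs, -, hgs, hφ⟩ := exists_isPseudoIsomorphism_elementary_holds p Y hY
  have hfs' : ∀ f ∈ fs, f.1.IsDistinguishedAt (IsLocalRing.maximalIdeal ℤ_[p]) :=
    fun f hf => (hfs f hf).1
  have hgs' : ∀ g ∈ gs, g.1.IsDistinguishedAt (IsLocalRing.maximalIdeal ℤ_[p]) :=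
    fun g hg => (hgs g hg).1
  have hcX := charIdeal_eq_span_holds p X hfs' hψ
  have hcY := charIdeal_eq_span_holds p Y hgs' hφ
  rw [muInvariant_eq_sum_holds p X hfs' hψ, muInvariant_eq_sum_holds p Y hgs' hφ] at hμ
  rw [hcX, hcY, Ideal.span_singleton_mul_span_singleton,
    Ideal.span_singleton_le_span_singleton, charElement_eq_C_pow_mul, charElement_eq_C_pow_mul,
    ← map_natCast (PowerSeries.C (R := ℤ_[p])) p] at h
  rw [hcX, hcY, Ideal.span_singleton_le_span_singleton, charElement_eq_C_pow_mul,
    charElement_eq_C_pow_mul]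
  -- `h : C p ^ a * D_X ∣ C p ^ k * (C p ^ b * D_Y)`; goal `C p ^ a * D_X ∣ C p ^ b * D_Y`
  have hD : (fs.map fun f => (f.1 : IwasawaAlgebra p) ^ f.2).prod ∣
      (gs.map fun f => (f.1 : IwasawaAlgebra p) ^ f.2).prod := by
    refine dvd_of_dvd_prime_pow_mul (prime_C p) (not_C_dvd_prod_pow_of_isDistinguishedAt hfs')
      (k + νs.sum) ?_
    rw [pow_add, mul_assoc]
    exact dvd_of_mul_left_dvd h
  exact mul_dvd_mul (pow_dvd_pow _ hμ) hD

/-- **A `μ`-inequality promotes a `p`-localized containment (squared form, the shape of the Heegner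
point main conjecture `char(𝔖/ℋ)^2 ⊆ char(X_tors)`).** For finitely generated torsion `Λ`-modules
`X`, `Y`: `(p^k) · char(Y)^2 ⊆ char(X)` and `μ(X) ≤ 2 μ(Y)` imply `char(Y)^2 ⊆ char(X)`. This is the
promotion step of Howard's `μ`-device (proof of Thm. 2.2.10, case `𝔓 = pΛ`, `𝔮 = T^m + p`), isolated
as pure `Λ`-algebra; it weakens the hypothesis `μ(X) = 0` of `le_charIdeal_of_span_p_pow_mul_le`.
[cite: Howard2004, proof of Thm. 2.2.10] [cite: Washington1997, §13.2] -/
theorem sq_charIdeal_le_charIdeal_of_span_p_pow_mul_le_of_muInvariant_le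
    {X : Type*} [AddCommGroup X] [_root_.Module (IwasawaAlgebra p) X]
    {Y : Type*} [AddCommGroup Y] [_root_.Module (IwasawaAlgebra p) Y]
    [Module.Finite (IwasawaAlgebra p) X] [Module.Finite (IwasawaAlgebra p) Y]
    (hX : Module.IsTorsion (IwasawaAlgebra p) X) (hY : Module.IsTorsion (IwasawaAlgebra p) Y)
    {k : ℕ}
    (h : Ideal.span {(p : IwasawaAlgebra p) ^ k} * Module.charIdeal (IwasawaAlgebra p) Y ^ 2 ≤
      Module.charIdeal (IwasawaAlgebra p) X)
    (hμ : muInvariant p X ≤ 2 * muInvariant p Y) :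
    Module.charIdeal (IwasawaAlgebra p) Y ^ 2 ≤ Module.charIdeal (IwasawaAlgebra p) X := by
  obtain ⟨μs, fs, -, hfs, hψ⟩ := exists_isPseudoIsomorphism_elementary_holds p X hX
  obtain ⟨νs, gs, -, hgs, hφ⟩ := exists_isPseudoIsomorphism_elementary_holds p Y hY
  have hfs' : ∀ f ∈ fs, f.1.IsDistinguishedAt (IsLocalRing.maximalIdeal ℤ_[p]) :=
    fun f hf => (hfs f hf).1
  have hgs' : ∀ g ∈ gs, g.1.IsDistinguishedAt (IsLocalRing.maximalIdeal ℤ_[p]) :=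
    fun g hg => (hgs g hg).1
  have hcX := charIdeal_eq_span_holds p X hfs' hψ
  have hcY := charIdeal_eq_span_holds p Y hgs' hφ
  rw [muInvariant_eq_sum_holds p X hfs' hψ, muInvariant_eq_sum_holds p Y hgs' hφ] at hμ
  rw [hcX, hcY, Ideal.span_singleton_pow, Ideal.span_singleton_mul_span_singleton,
    Ideal.span_singleton_le_span_singleton, charElement_eq_C_pow_mul, charElement_eq_C_pow_mul,
    ← map_natCast (PowerSeries.C (R := ℤ_[p])) p] at h
  rw [hcX, hcY, Ideal.span_singleton_pow, Ideal.span_singleton_le_span_singleton,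
    charElement_eq_C_pow_mul, charElement_eq_C_pow_mul]
  -- `h : C p ^ a * D_X ∣ C p ^ k * (C p ^ b * D_Y) ^ 2`; goal `C p ^ a * D_X ∣ (C p ^ b * D_Y) ^ 2`
  rw [mul_pow, ← pow_mul, mul_comm νs.sum 2] at h ⊢
  have hD : (fs.map fun f => (f.1 : IwasawaAlgebra p) ^ f.2).prod ∣
      (gs.map fun f => (f.1 : IwasawaAlgebra p) ^ f.2).prod ^ 2 := by
    refine dvd_of_dvd_prime_pow_mul (prime_C p) (not_C_dvd_prod_pow_of_isDistinguishedAt hfs')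
      (k + 2 * νs.sum) ?_
    rw [pow_add, mul_assoc]
    exact dvd_of_mul_left_dvd h
  exact mul_dvd_mul (pow_dvd_pow _ hμ) hD

/-- **The same promotion with the `μ`-hypothesis in the tree's `lengthAt` currency** (no `toNat`;
appended): for the height-one prime `𝔭 = (p)` of `Λ` and finitely generated torsion `X`, `Y`,
`(p^k) · char(Y) ⊆ char(X)` and `length X_𝔭 ≤ length Y_𝔭` imply `char(Y) ⊆ char(X)` (both lengths
are finite, `lengthAt_ne_top_of_isTorsion`, and `μ = toNat ∘ length_𝔭`,
`muInvariant_eq_toNat_lengthAt`).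
Washington §13.2. [cite: Washington1997, §13.2] -/
theorem charIdeal_le_charIdeal_of_span_p_pow_mul_le_of_lengthAt_le
    {X : Type*} [AddCommGroup X] [_root_.Module (IwasawaAlgebra p) X]
    {Y : Type*} [AddCommGroup Y] [_root_.Module (IwasawaAlgebra p) Y]
    [Module.Finite (IwasawaAlgebra p) X] [Module.Finite (IwasawaAlgebra p) Y]
    (hX : Module.IsTorsion (IwasawaAlgebra p) X) (hY : Module.IsTorsion (IwasawaAlgebra p) Y)
    {k : ℕ}
    (h : Ideal.span {(p : IwasawaAlgebra p) ^ k} * Module.charIdeal (IwasawaAlgebra p) Y ≤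
      Module.charIdeal (IwasawaAlgebra p) X)
    (𝔭 : PrimeSpectrum (IwasawaAlgebra p)) (h𝔭 : 𝔭.asIdeal = augIdealP p)
    (hμ : Module.lengthAt (IwasawaAlgebra p) X 𝔭 ≤ Module.lengthAt (IwasawaAlgebra p) Y 𝔭) :
    Module.charIdeal (IwasawaAlgebra p) Y ≤ Module.charIdeal (IwasawaAlgebra p) X := by
  refine charIdeal_le_charIdeal_of_span_p_pow_mul_le_of_muInvariant_le hX hY h ?_
  rw [muInvariant_eq_toNat_lengthAt p X 𝔭 h𝔭, muInvariant_eq_toNat_lengthAt p Y 𝔭 h𝔭]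
  obtain ⟨a, ha⟩ := ENat.ne_top_iff_exists.mp (lengthAt_ne_top_of_isTorsion p X hX 𝔭 h𝔭)
  obtain ⟨b, hb⟩ := ENat.ne_top_iff_exists.mp (lengthAt_ne_top_of_isTorsion p Y hY 𝔭 h𝔭)
  rw [← ha, ← hb] at hμ
  rw [← ha, ← hb, ENat.toNat_coe, ENat.toNat_coe]
  exact_mod_cast hμ

/-- **Squared form in the `lengthAt` currency** (appended): for the height-one prime `𝔭 = (p)` and
finitely generated torsion `X`, `Y`, `(p^k) · char(Y)^2 ⊆ char(X)` and `length X_𝔭 ≤ 2 · length Y_𝔭`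
imply `char(Y)^2 ⊆ char(X)` — the promotion step of Howard's `μ`-device with its hypothesis stated
as the local-length inequality `ord_{(p)} char(X_tors) ≤ 2 · ord_{(p)} char(𝔖/ℋ)` it produces.
[cite: Howard2004, proof of Thm. 2.2.10] [cite: Washington1997, §13.2] -/
theorem sq_charIdeal_le_charIdeal_of_span_p_pow_mul_le_of_lengthAt_le
    {X : Type*} [AddCommGroup X] [_root_.Module (IwasawaAlgebra p) X]
    {Y : Type*} [AddCommGroup Y] [_root_.Module (IwasawaAlgebra p) Y]
    [Module.Finite (IwasawaAlgebra p) X] [Module.Finite (IwasawaAlgebra p) Y]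
    (hX : Module.IsTorsion (IwasawaAlgebra p) X) (hY : Module.IsTorsion (IwasawaAlgebra p) Y)
    {k : ℕ}
    (h : Ideal.span {(p : IwasawaAlgebra p) ^ k} * Module.charIdeal (IwasawaAlgebra p) Y ^ 2 ≤
      Module.charIdeal (IwasawaAlgebra p) X)
    (𝔭 : PrimeSpectrum (IwasawaAlgebra p)) (h𝔭 : 𝔭.asIdeal = augIdealP p)
    (hμ : Module.lengthAt (IwasawaAlgebra p) X 𝔭 ≤ 2 * Module.lengthAt (IwasawaAlgebra p) Y 𝔭) :
    Module.charIdeal (IwasawaAlgebra p) Y ^ 2 ≤ Module.charIdeal (IwasawaAlgebra p) X := by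
  refine sq_charIdeal_le_charIdeal_of_span_p_pow_mul_le_of_muInvariant_le hX hY h ?_
  rw [muInvariant_eq_toNat_lengthAt p X 𝔭 h𝔭, muInvariant_eq_toNat_lengthAt p Y 𝔭 h𝔭]
  obtain ⟨a, ha⟩ := ENat.ne_top_iff_exists.mp (lengthAt_ne_top_of_isTorsion p X hX 𝔭 h𝔭)
  obtain ⟨b, hb⟩ := ENat.ne_top_iff_exists.mp (lengthAt_ne_top_of_isTorsion p Y hY 𝔭 h𝔭)
  rw [← ha, ← hb] at hμ
  rw [← ha, ← hb, ENat.toNat_coe, ENat.toNat_coe]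
  exact_mod_cast hμ

end IwasawaAlgebra

end Literature.NumberTheory.EllipticCurves

end
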